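import Summits.BirchSwinnertonDyer.Rank1Residual.GaloisImage.FiniteSingularComparisonNakayama
import Summits.BirchSwinnertonDyer.Rank1Residual.GaloisImage.FiniteSingularComparisonOperator
import HarnessLib

/-!
# The canonical finite–singular comparison map is an isomorphism, VIII: Rubin's operator
# `Q(φ⁻¹)` maps `M/(φ − 1)M` isomorphically onto `M^{φ=1}` — PRIME-POWER modulus `ℤ/p^n`
# (cell `b2b-bsdres`, team n1011, seat p11 gen 4, OWNERS row T-HCC-adm, sequel F2′; file 8)

HONEST FRAMING (cell `b2b-bsdres`, run/shared/lean/b2b/bsd-rank1-residual/, verbatim in every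
file): the goal of the cell is to DELETE the COMBINATION-SHAPED residual classes of the
Birch–Swinnerton-Dyer formula for ALL analytic-rank `≤ 1` elliptic curves over `ℚ` — "full BSD
formula for every rank `≤ 1` curve in class `C`" assembled STRICTLY from published theorems — so
that the rank-`≤ 1` remainder becomes exactly the CONSTRUCTION-SHAPED classes, which are TYPED
(missing-input `Prop`s), NOT attempted. This is not "finishing BSD". Team n1011 (N10 / N11, the
additive block X4 ∧ `p = 3`): research route on the CONSTRUCTION-SHAPED class X4; no claim beyond the
stated classes; nothing is booked. TOOL theorems of linear algebra; no definition, no named fact,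
no `sorry`.

## What is proved

The prime-power version of file 2 (`FiniteSingularComparisonOperator`, prime modulus): for a
discrete `Γ_F`-module `M`, free of finite rank over `ℤ/p^n` (`n ≥ 1`), and `φ ∈ Γ_F` with
`M/(φ − 1)M ≃ ℤ/p^n` (the (H.2) shape at level `p^n`, e.g. `E[3^{k+1}]` in the N11 chain):

* `FSComp.mem_range_of_map_eq_zero_of_fixed` — a modulus-free counting lemma: an additive map
  `T : M → M` of a finite group killing `(g − 1)M`, with values in, and onto, the fixed points of
  `g`, is injective modulo `(g − 1)M` (`#M/(g − 1)M = #M^{g=1}`);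
* `FSComp.comparisonQ_eq_C_mul_divByMonic_of_eval` (any modulus) — `Q = C u · (χ_{φ⁻¹} /ₘ (X − 1))`
  as soon as `P(1) = 0`;
* **`FSComp.exists_comparisonOp_eq_of_apply_eq_primePow`** — `Q(φ⁻¹)` maps ONTO `M^{φ=1}`
  (file 7, `PrimePow.exists_aeval_divByMonic_charpoly_eq`: reduction mod `p` + Nakayama);
* **`FSComp.mem_range_of_comparisonOp_eq_zero_primePow`** — `Q(φ⁻¹) m = 0 ⟹ m ∈ (φ − 1)M`.

Together: [MR04] Lemma 1.2.3, first map, for `R = ℤ/p^n`.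

References: B. Mazur, K. Rubin, Mem. AMS 799 (2004), Def. 1.2.2, Lemma 1.2.3 (pp. 10–11); K. Rubin,
PCMI 18 (2011), Def. 1.9.6, Ex. 1.9.7.
-/

noncomputable section

open Field Polynomial Module
open Literature.NumberTheory.GaloisRepresentations
open Literature.NumberTheory.GaloisRepresentations.DiscreteGaloisModule
open scoped ContRepresentation Polynomial

universe u

namespace Summit.BirchSwinnertonDyer.Rank1Residual.GaloisImage.FSComp

/-! ### §1 A modulus-free counting lemma -/

/-- **Injective modulo `(g − 1)M` by counting.**  Let `M` be a finite abelian group, `g : M → M`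
additive, `T : M → M` additive, killing `(g − 1)M`, with `g (T m) = T m` for all `m`, and such
that every fixed point of `g` is a value of `T`.  Then `T m = 0 ⟹ m ∈ (g − 1)M`: `T` factors
through `M/(g − 1)M`, whose order equals `#M^{g=1}` (`#ker = #coker`), onto `M^{g=1}`, so the
factored map is injective. [folklore] -/
theorem mem_range_of_map_eq_zero_of_fixed {A : Type*} [AddCommGroup A] [Finite A] (g T : A →+ A)
    (hkill : ∀ y, T (g y - y) = 0) (hfix : ∀ m, g (T m) = T m)
    (hsurj : ∀ a, g a = a → ∃ m, T m = a) {m : A} (hm : T m = 0) : m ∈ (g - AddMonoidHom.id A).range := by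
  classical
  set R := (g - AddMonoidHom.id A).range with hR
  set Fix := (g - AddMonoidHom.id A).ker with hFix
  have hTR : R ≤ T.ker := by
    rintro _ ⟨y, rfl⟩
    rw [AddMonoidHom.mem_ker, AddMonoidHom.sub_apply, AddMonoidHom.id_apply]
    exact hkill y
  set Tbar : A ⧸ R →+ A := QuotientAddGroup.lift R T hTR with hTbar
  have hcardFix : Nat.card Fix = Nat.card (A ⧸ R) := natCard_ker_eq_natCard_quotient_range _
  have hFixle : Fix ≤ Tbar.range := by
    intro a ha
    have ha' : g a = a := by
      rw [hFix, AddMonoidHom.mem_ker, AddMonoidHom.sub_apply, AddMonoidHom.id_apply, sub_eq_zero] at ha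
      exact ha
    obtain ⟨x, hx⟩ := hsurj a ha'
    exact ⟨QuotientAddGroup.mk x, by rw [hTbar, QuotientAddGroup.lift_mk, hx]⟩
  have hrange_le : Tbar.range ≤ Fix := by
    rintro _ ⟨x, rfl⟩
    obtain ⟨y, rfl⟩ := QuotientAddGroup.mk_surjective x
    rw [hTbar, QuotientAddGroup.lift_mk, hFix, AddMonoidHom.mem_ker, AddMonoidHom.sub_apply,
      AddMonoidHom.id_apply, sub_eq_zero]
    exact hfix y
  have hrange : Tbar.range = Fix := le_antisymm hrange_le hFixle
  have hker : Tbar.ker = ⊥ := by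
    have h2 := AddSubgroup.card_eq_card_quotient_mul_card_addSubgroup Tbar.ker
    rw [Nat.card_congr (QuotientAddGroup.quotientKerEquivRange Tbar).toEquiv, hrange, hcardFix] at h2
    have hpos : 0 < Nat.card (A ⧸ R) := Nat.card_pos
    have hker1 : Nat.card Tbar.ker = 1 := by
      have hkpos : 0 < Nat.card Tbar.ker := Nat.card_pos
      nlinarith
    exact AddSubgroup.card_eq_one.mp hker1
  have hmk : (QuotientAddGroup.mk m : A ⧸ R) ∈ Tbar.ker := by
    rw [AddMonoidHom.mem_ker, hTbar, QuotientAddGroup.lift_mk, hm]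
  rw [hker, AddSubgroup.mem_bot, QuotientAddGroup.eq_zero_iff] at hmk
  exact hmk

/-! ### §2 `Q = C u · Q₁` from `P(1) = 0`, any modulus -/

section AnyModulus

variable {F : Type u} [Field F] {M : Type u} [AddCommGroup M] [TopologicalSpace M]
  [DiscreteTopology M]
variable (ρ : DiscreteGaloisModule F M) (N : ℕ) [Module (ZMod N) M]
  [Module.Free (ZMod N) M] [Module.Finite (ZMod N) M]

/-- **`χ_{φ⁻¹}(1) = 0` and `Q = C u · (χ_{φ⁻¹} /ₘ (X − 1))`, `u` a unit, as soon as `P(1) = 0`**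
(`P = C u · χ_{φ⁻¹}`, file 2; uniqueness of division by the monic `X − 1`). [folklore] -/
theorem comparisonQ_eq_C_mul_divByMonic_of_eval [Fact (1 < N)] (φ : absoluteGaloisGroup F)
    (h1 : (ρ.comparisonP N φ).eval 1 = 0) :
    ∃ u : ZMod N, IsUnit u ∧ ((ρ.zmodEnd N φ⁻¹).charpoly).IsRoot 1 ∧
      ρ.comparisonQ N φ = C u * ((ρ.zmodEnd N φ⁻¹).charpoly /ₘ (X - C 1)) := by
  obtain ⟨u, hu, hP⟩ := comparisonP_eq_C_mul_charpoly_inv ρ N φ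
  have hroot : ((ρ.zmodEnd N φ⁻¹).charpoly).IsRoot 1 := by
    rw [hP, eval_mul, eval_C] at h1
    exact (hu.mul_right_eq_zero).mp h1
  refine ⟨u, hu, hroot, ?_⟩
  have hmul : (X - C (1 : ZMod N)) * ((ρ.zmodEnd N φ⁻¹).charpoly /ₘ (X - C 1)) =
      (ρ.zmodEnd N φ⁻¹).charpoly := mul_divByMonic_eq_iff_isRoot.mpr hroot
  rw [DiscreteGaloisModule.comparisonQ]
  refine (Polynomial.div_modByMonic_unique _ 0 (monic_X_sub_C (1 : ZMod N)) ⟨?_, ?_⟩).1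
  · rw [zero_add, mul_left_comm, hmul, hP]
  · rw [degree_zero, degree_X_sub_C]
    exact WithBot.bot_lt_coe 1

end AnyModulus

/-! ### §3 Prime-power modulus: `Q(φ⁻¹)` is onto `M^{φ=1}` and injective modulo `(φ − 1)M` -/

section PrimePowModulus

variable {F : Type u} [Field F] {M : Type u} [AddCommGroup M] [TopologicalSpace M]
  [DiscreteTopology M]
variable (ρ : DiscreteGaloisModule F M) (p n : ℕ) [Fact p.Prime] [NeZero n]
  [Module (ZMod (p ^ n)) M] [Module.Free (ZMod (p ^ n)) M] [Module.Finite (ZMod (p ^ n)) M]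

omit [Fact p.Prime] [NeZero n] [Module.Free (ZMod (p ^ n)) M] [Module.Finite (ZMod (p ^ n)) M] in
/-- `(φ⁻¹ − 1)M = (φ − 1)M` (as subgroups: `φ⁻¹ y − y = φ(−φ⁻¹ y) − (−φ⁻¹ y)`). [folklore] -/
theorem range_zmodEnd_inv_sub_one_toAddSubgroup_eq (φ : absoluteGaloisGroup F) :
    (LinearMap.range (ρ.zmodEnd (p ^ n) φ⁻¹ - 1)).toAddSubgroup =
      ((ρ φ : M →ₗ[ℤ] M).toAddMonoidHom - AddMonoidHom.id M).range := by
  have hgi : ∀ m, ρ φ⁻¹ (ρ φ m) = m := fun m => by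
    rw [← Module.End.mul_apply, ← map_mul, inv_mul_cancel, map_one, Module.End.one_apply]
  have hig : ∀ m, ρ φ (ρ φ⁻¹ m) = m := fun m => by
    rw [← Module.End.mul_apply, ← map_mul, mul_inv_cancel, map_one, Module.End.one_apply]
  ext m
  rw [Submodule.mem_toAddSubgroup, LinearMap.mem_range, AddMonoidHom.mem_range]
  simp only [LinearMap.sub_apply, Module.End.one_apply, zmodEnd_apply, AddMonoidHom.sub_apply,
    LinearMap.toAddMonoidHom_coe, AddMonoidHom.id_apply]
  constructor
  · rintro ⟨y, rfl⟩
    exact ⟨-ρ φ⁻¹ y, by rw [map_neg, hig]; abel⟩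
  · rintro ⟨z, rfl⟩
    exact ⟨-ρ φ z, by rw [map_neg, hgi]; abel⟩

/-- **`Q(φ⁻¹)` maps ONTO `M^{φ=1}` at prime-power modulus** `ℤ/p^n`, when `M/(φ − 1)M ≃ ℤ/p^n`:
[MR04] Lemma 1.2.3, first map (file 7's reduction-mod-`p` + Nakayama theorem applied to
`ψ = φ⁻¹`, whose fixed vectors are those of `φ`).
[cite: MazurRubin2004, Lemma 1.2.3 (p. 10–11)] [cite: Rubin2011, Exercise 1.9.7 (p. 15)] -/
theorem exists_comparisonOp_eq_of_apply_eq_primePow (φ : absoluteGaloisGroup F)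
    (hcok : Nonempty (Literature.NumberTheory.GaloisCohomology.cokerSubOne ρ φ ≃+ ZMod (p ^ n)))
    (a : M) (ha : ρ φ a = a) : ∃ m : M, ρ.comparisonOp (p ^ n) φ m = a := by
  haveI : NeZero (p ^ n) := ⟨pow_ne_zero _ (Fact.out : p.Prime).ne_zero⟩
  haveI : Fact (1 < p ^ n) := ⟨Nat.one_lt_pow (NeZero.ne n) (Fact.out : p.Prime).one_lt⟩
  have h1 : (ρ.comparisonP (p ^ n) φ).eval 1 = 0 :=
    eval_one_comparisonP_eq_zero_of_cokerSubOne ρ (p ^ n) φ hcok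
  obtain ⟨u, hu, hroot, hQ⟩ := comparisonQ_eq_C_mul_divByMonic_of_eval ρ (p ^ n) φ h1
  -- transfer the cokernel hypothesis to `ψ = zmodEnd φ⁻¹`
  have hcok' : Nonempty ((M ⧸ (LinearMap.range (ρ.zmodEnd (p ^ n) φ⁻¹ - 1)).toAddSubgroup) ≃+
      ZMod (p ^ n)) := by
    obtain ⟨e⟩ := hcok
    exact ⟨(QuotientAddGroup.quotientAddEquivOfEq
      (range_zmodEnd_inv_sub_one_toAddSubgroup_eq ρ p n φ)).trans e⟩
  obtain ⟨v, hv⟩ := hu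
  have ha' : ρ.zmodEnd (p ^ n) φ⁻¹ (((v⁻¹ : (ZMod (p ^ n))ˣ) : ZMod (p ^ n)) • a) =
      ((v⁻¹ : (ZMod (p ^ n))ˣ) : ZMod (p ^ n)) • a := by
    have h := (mem_ker_zmodEnd_inv_sub_one_iff ρ (p ^ n) φ
      (((v⁻¹ : (ZMod (p ^ n))ˣ) : ZMod (p ^ n)) • a)).mpr (by
        rw [← ZMod.natCast_zmod_val (((v⁻¹ : (ZMod (p ^ n))ˣ) : ZMod (p ^ n))),
          Nat.cast_smul_eq_nsmul, map_nsmul, ha])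
    rw [LinearMap.mem_ker, LinearMap.sub_apply, Module.End.one_apply, sub_eq_zero] at h
    exact h
  obtain ⟨m, hm⟩ := PrimePow.exists_aeval_divByMonic_charpoly_eq (ρ.zmodEnd (p ^ n) φ⁻¹) hcok'
    hroot _ ha'
  refine ⟨m, ?_⟩
  rw [comparisonOp_def, hQ, map_mul, aeval_C, Module.End.mul_apply, hm, Module.algebraMap_end_apply,
    ← hv, smul_smul, Units.mul_inv, one_smul]

/-- **`Q(φ⁻¹) m = 0 ⟹ m ∈ (φ − 1)M` at prime-power modulus**, when `M/(φ − 1)M ≃ ℤ/p^n` (the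
surjectivity above + the counting lemma `mem_range_of_map_eq_zero_of_fixed`).
[cite: MazurRubin2004, Lemma 1.2.3 (p. 10–11)] -/
theorem mem_range_of_comparisonOp_eq_zero_primePow (φ : absoluteGaloisGroup F)
    (hcok : Nonempty (Literature.NumberTheory.GaloisCohomology.cokerSubOne ρ φ ≃+ ZMod (p ^ n)))
    (m : M) (hm : ρ.comparisonOp (p ^ n) φ m = 0) :
    m ∈ ((ρ φ : M →ₗ[ℤ] M).toAddMonoidHom - AddMonoidHom.id M).range := by
  haveI : NeZero (p ^ n) := ⟨pow_ne_zero _ (Fact.out : p.Prime).ne_zero⟩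
  haveI : Finite M := Module.finite_of_finite (ZMod (p ^ n))
  have h1 : (ρ.comparisonP (p ^ n) φ).eval 1 = 0 :=
    eval_one_comparisonP_eq_zero_of_cokerSubOne ρ (p ^ n) φ hcok
  refine mem_range_of_map_eq_zero_of_fixed (ρ φ : M →ₗ[ℤ] M).toAddMonoidHom
    (ρ.comparisonOp (p ^ n) φ).toAddMonoidHom (fun y => ?_) (fun x => ?_) (fun a ha => ?_) ?_
  · rw [LinearMap.toAddMonoidHom_coe, LinearMap.toAddMonoidHom_coe]
    exact comparisonOp_apply_sub ρ (p ^ n) φ h1 y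
  · rw [LinearMap.toAddMonoidHom_coe, LinearMap.toAddMonoidHom_coe]
    exact apply_comparisonOp ρ (p ^ n) φ h1 x
  · rw [LinearMap.toAddMonoidHom_coe] at ha
    obtain ⟨x, hx⟩ := exists_comparisonOp_eq_of_apply_eq_primePow ρ p n φ hcok a ha
    exact ⟨x, by rw [LinearMap.toAddMonoidHom_coe, hx]⟩
  · rw [LinearMap.toAddMonoidHom_coe, hm]

end PrimePowModulus

end Summit.BirchSwinnertonDyer.Rank1Residual.GaloisImage.FSComp

end
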